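import Literature.Computability.Cryptography.ChenQuantumLWEClassTwirl

/-!
# What the registers reveal about the offset without the secret: line invariants, Step 8, and the class `K` (T4, modelling half)

REPRODUCTION / ANALYSIS OF A CLAIMED RESULT UNDER ADJUDICATION (withdrawn): Yilei Chen, *Quantum
Algorithms for Lattice Problems*, IACR ePrint 2024/555, version of 2024-04-18 [ChenQuantumLattice2024]
(the version carrying the author's note that Step 9 contains a bug), Step 8 (Claim 3.14, pp. 33–34:
the value `v′₀ mod D²p₁` is learned) and Step 9 (§3.5.9, pp. 34–38) acting on
`|φ8.b⟩ = Σ_{j ∈ ℤ_P} e(-j²/P) |2D²j·b + v′ mod N⟩` (p. 35), `P = p₁Q`, `N = D²P`; eq. (12) p. 17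
(`b_i ∈ 2p₁ℤ` on the unknown coordinates).  Bundle `papers/QuantumAdvantage/lwe-quantum-autopsy/`,
Part 2 (`REPAIR-CENSUS.md` §0 (i)–(ii), §1 theorem **T4**, §11), companion of
`ChenQuantumLWEClassTwirl.lean` (the class twirl over the shifts `d(a,c)` is secret-blind) and
`ChenQuantumLWEClassTwirlSharp.lean` (and no finer twirl is).
HONEST FRAMING: kernel-checked THEOREMS about a state occurring in a WITHDRAWN algorithm — the exact
bookkeeping of which offset information is available without the secret (the modelling hypothesis of the
no-go T4 made a theorem), NOT summit progress, no cryptanalytic claim in either direction, no new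
algorithm; quantum lower bounds are out of scope.

## What is proved

Fix the set `U` of unknown coordinates and a public vector `bk` (`≡ 0 (mod 2p₁)` on `U`, e.g. `0`
there); the INSTANCE CLASS (`InClass`) is the set of integer vectors agreeing with `bk` off `U` and
`≡ 0 (mod 2p₁)` on `U` (eq. (12)).  The support of `|φ8.b⟩` is the LINE `{2D²j·b + v′ : j ∈ ℤ_P}` of
`ℤ_N^{n+1}` (`ptB`).  A LINE INVARIANT (`IsLineInvariant`) is a function of the registers constant on
every line of every secret of the class (every offset): exactly the register functions that can be
measured on ONE copy of `|φ8.b⟩` without disturbing it and without knowing the secret, and whose value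
then is its value at `v′`.

* `isLineInvariant_iff_periodic`: `f` is a line invariant iff it is periodic under the SPAN OF THE
  ADMISSIBLE DIRECTIONS `H = {2D²(m·bk + 2p₁e·𝟙_U) mod N}` (`InDirSpan`).  So the line invariants
  reveal exactly the coset `v′ + H`, nothing finer.
* `inDirSpan_classShift`, `toStep8_classShift`: every class shift `d(a,c) = D²p₁(a·bk + c·𝟙_U)`
  (`ChenQuantumLWEClassTwirl.classShift`) lies in `H` (odd `Q`) and has Step-8 value `0`
  (`toStep8 : ℤ_N → ℤ_{D²p₁}`, `0 ∉ U`); hence (`IsLineInvariant.apply_classShift`) NO line invariant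
  and NOT Step 8 separates `v′` from `v′ + d(a,c)`.
* **`exists_classShift_of_inDirSpan`** (the converse): for odd `p₁`, odd `Q`, `0 ∉ U`, `bk₀ = −1`, an
  element of `H` with Step-8 value `0` IS a class shift mod `N` (`p₁ ∣ m` is forced in coordinate `0`;
  `2` and `4` are units mod `Q`); `inDirSpan_step8_iff_classShift` is the equivalence.
* **`offset_indistinguishable_iff`** (T4, modelling half): two offsets `v′, v″` receive the same value
  of EVERY line invariant and the same Step-8 datum `v′₀ mod D²p₁` if and only if
  `v″ ≡ v′ + d(a,c) (mod N)` for some class shift.  Together with `ChenQuantumLWEClassTwirl`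
  (`twirledGram_secret_indep`: averaging over the `d(a,c)` makes the run's state secret-independent) and
  `ChenQuantumLWEClassTwirlSharp` (no finer average is secret-blind): a post-processing of `|φ8.b⟩`
  driven by line invariants and Step 8 alone — Chen's Step 9 is of this kind — cannot depend on the
  LWE secret on average over the offsets it cannot tell apart.

## What is NOT here

Information about `v′` from sources other than non-disturbing register functions and Claim 3.14
(e.g. partially measuring the line coordinate, which destroys the state: `ChenQuantumLWEWindowProfile`,
`…WindowBound`, `…WindowVariation`) is not modelled here; even moduli are excluded where stated;
nothing about Steps 1–7.

References: [ChenQuantumLattice2024] as above; [ZhangExactCoset2025] Y. Zhang, arXiv:2509.12341, p. 22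
(AC4: the datum `v′₀ mod P`, which is NOT a line invariant, does separate the class —
`ChenQuantumLWEChirpFourier.Shape.weight_qft_kick_phi8b_of_correct`).
-/

namespace Literature.Computability.Cryptography.Chen2024

open scoped BigOperators

section LineInvariants

variable (n : ℕ) (D p₁ Q : ℕ+)

/-! ### Casting integer multiples of `2D²` and `D²p₁` into `ℤ_N` -/

/-- `2D²·m·b mod N` depends on `m mod P` only (`N = D²P`). [folklore] -/
theorem twoDsq_mul_eq_of_modEq (b : ℤ) {m m' : ℤ} (h : m ≡ m' [ZMOD (((p₁ * Q : ℕ+) : ℕ) : ℤ)]) :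
    ((2 * ((D : ℕ) : ℤ) ^ 2 * m * b : ℤ) : ZN D p₁ Q) = ((2 * ((D : ℕ) : ℤ) ^ 2 * m' * b : ℤ) : ZN D p₁ Q) := by
  rw [ZMod.intCast_eq_intCast_iff_dvd_sub]
  obtain ⟨k, hk⟩ := h.dvd
  refine ⟨2 * b * k, ?_⟩
  have hk' : m' = m + ((p₁ : ℕ) : ℤ) * ((Q : ℕ) : ℤ) * k := by
    push_cast at hk
    linear_combination hk
  rw [hk']
  push_cast
  ring

/-- `D²p₁·x mod N` depends on `x mod Q` only (`N = D²p₁Q`). [folklore] -/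
theorem Dsq_p₁_mul_eq_of_modEq {x y : ℤ} (h : x ≡ y [ZMOD (((Q : ℕ+) : ℕ) : ℤ)]) :
    ((((D : ℕ) : ℤ) ^ 2 * ((p₁ : ℕ) : ℤ) * x : ℤ) : ZN D p₁ Q)
      = ((((D : ℕ) : ℤ) ^ 2 * ((p₁ : ℕ) : ℤ) * y : ℤ) : ZN D p₁ Q) := by
  rw [ZMod.intCast_eq_intCast_iff_dvd_sub]
  obtain ⟨k, hk⟩ := h.dvd
  refine ⟨k, ?_⟩
  have hk' : y = x + ((Q : ℕ) : ℤ) * k := by linear_combination hk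
  rw [hk']
  push_cast
  ring

/-! ### The Step-8 datum `v′₀ mod D²p₁` -/

/-- `D²p₁ ∣ N`. [folklore] -/
theorem Dsqp₁_dvd_N : ((D * D * p₁ : ℕ+) : ℕ) ∣ ((D * D * (p₁ * Q) : ℕ+) : ℕ) :=
  ⟨Q, by push_cast; ring⟩

/-- The reduction `ℤ_N → ℤ_{D²p₁}`: applied to coordinate `0` of the offset it is the Step-8 datum
`v′₀ mod D²p₁` of Claim 3.14. [cite: ChenQuantumLattice2024, Claim 3.14 pp. 33–34] -/
def toStep8 : ZN D p₁ Q →+* ZMod ((D * D * p₁ : ℕ+) : ℕ) :=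
  ZMod.castHom (Dsqp₁_dvd_N D p₁ Q) (ZMod ((D * D * p₁ : ℕ+) : ℕ))

/-- `toStep8` of an integer. [folklore] -/
theorem toStep8_intCast (z : ℤ) :
    toStep8 D p₁ Q ((z : ℤ) : ZN D p₁ Q) = ((z : ℤ) : ZMod ((D * D * p₁ : ℕ+) : ℕ)) :=
  map_intCast _ z

/-! ### The instance class, the line directions, the span `H` -/

/-- The INSTANCE CLASS of secrets relative to the unknown coordinates `U` and the public part `bk`:
agree with `bk` off `U`, `≡ 0 (mod 2p₁)` on `U`. [cite: ChenQuantumLattice2024, eq. (12) p. 17] -/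
def InClass (U : Finset (Fin (n + 1))) (bk b : Fin (n + 1) → ℤ) : Prop :=
  (∀ i, i ∉ U → b i = bk i) ∧ ∀ i, i ∈ U → (2 * ((p₁ : ℕ) : ℤ)) ∣ b i

/-- The direction step `2D²·m·b mod N` of the line of secret `b`. [cite: ChenQuantumLattice2024, §3.5.9 p. 35] -/
def dirStep (m : ℤ) (b : Fin (n + 1) → ℤ) : Fin (n + 1) → ZN D p₁ Q :=
  fun i => ((2 * ((D : ℕ) : ℤ) ^ 2 * m * b i : ℤ) : ZN D p₁ Q)

/-- The SPAN OF THE ADMISSIBLE DIRECTIONS mod `N`: `H = {2D²(m·bk + 2p₁e·𝟙_U)}`. [folklore] -/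
def InDirSpan (U : Finset (Fin (n + 1))) (bk : Fin (n + 1) → ℤ) (h : Fin (n + 1) → ZN D p₁ Q) : Prop :=
  ∃ m : ℤ, ∃ e : Fin (n + 1) → ℤ, ∀ i,
    h i = ((2 * ((D : ℕ) : ℤ) ^ 2 * (m * bk i + if i ∈ U then 2 * ((p₁ : ℕ) : ℤ) * e i else 0) : ℤ)
            : ZN D p₁ Q)

/-- A LINE INVARIANT: a function of the registers constant on the line `{2D²j·b + v′}` of every secret
`b` of the class and every offset `v′`. [cite: ChenQuantumLattice2024, §3.5.9 p. 35] -/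
def IsLineInvariant {X : Type*} (U : Finset (Fin (n + 1))) (bk : Fin (n + 1) → ℤ)
    (f : (Fin (n + 1) → ZN D p₁ Q) → X) : Prop :=
  ∀ b, InClass n p₁ U bk b → ∀ (v' : Fin (n + 1) → ℤ) (j j' : ZP p₁ Q),
    f (ptB n D p₁ Q b v' j) = f (ptB n D p₁ Q b v' j')

/-- The point of parameter `m` on the line is the offset plus the direction step.
[cite: ChenQuantumLattice2024, §3.5.9 p. 35] -/
theorem ptB_intCast (b v' : Fin (n + 1) → ℤ) (m : ℤ) :
    ptB n D p₁ Q b v' ((m : ℤ) : ZP p₁ Q)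
      = (fun i => ((v' i : ℤ) : ZN D p₁ Q)) + dirStep n D p₁ Q m b := by
  funext i
  have hm : (((((m : ℤ) : ZP p₁ Q)).val : ℕ) : ℤ) ≡ m [ZMOD (((p₁ * Q : ℕ+) : ℕ) : ℤ)] := by
    rw [ZMod.val_intCast]
    exact Int.mod_modEq _ _
  have key := twoDsq_mul_eq_of_modEq D p₁ Q (b i) hm
  simp only [ptB, dirStep, Pi.add_apply]
  rw [Int.cast_add, ← key, add_comm]

/-- The point of parameter `0` is the offset. [cite: ChenQuantumLattice2024, §3.5.9 p. 35] -/
theorem ptB_zero (b v' : Fin (n + 1) → ℤ) :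
    ptB n D p₁ Q b v' 0 = fun i => ((v' i : ℤ) : ZN D p₁ Q) := by
  have h := ptB_intCast n D p₁ Q b v' 0
  rw [Int.cast_zero] at h
  rw [h]
  funext i
  simp [dirStep]

/-- `0 ∈ H`. [folklore] -/
theorem inDirSpan_zero (U : Finset (Fin (n + 1))) (bk : Fin (n + 1) → ℤ) :
    InDirSpan n D p₁ Q U bk 0 :=
  ⟨0, fun _ => 0, fun i => by simp⟩

/-- `H` is closed under addition. [folklore] -/
theorem inDirSpan_add {U : Finset (Fin (n + 1))} {bk : Fin (n + 1) → ℤ} {h₁ h₂ : Fin (n + 1) → ZN D p₁ Q}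
    (H₁ : InDirSpan n D p₁ Q U bk h₁) (H₂ : InDirSpan n D p₁ Q U bk h₂) :
    InDirSpan n D p₁ Q U bk (h₁ + h₂) := by
  obtain ⟨m₁, e₁, hh₁⟩ := H₁
  obtain ⟨m₂, e₂, hh₂⟩ := H₂
  refine ⟨m₁ + m₂, fun i => e₁ i + e₂ i, fun i => ?_⟩
  rw [Pi.add_apply, hh₁ i, hh₂ i, ← Int.cast_add]
  congr 1
  by_cases hi : i ∈ U
  · simp only [hi, if_true]; ring
  · simp only [hi, if_false]; ring

/-- `H` is closed under negation. [folklore] -/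
theorem inDirSpan_neg {U : Finset (Fin (n + 1))} {bk : Fin (n + 1) → ℤ} {h : Fin (n + 1) → ZN D p₁ Q}
    (H : InDirSpan n D p₁ Q U bk h) : InDirSpan n D p₁ Q U bk (-h) := by
  obtain ⟨m, e, hh⟩ := H
  refine ⟨-m, fun i => -e i, fun i => ?_⟩
  rw [Pi.neg_apply, hh i, ← Int.cast_neg]
  congr 1
  by_cases hi : i ∈ U
  · simp only [hi, if_true]; ring
  · simp only [hi, if_false]; ring

/-- A line invariant is unchanged by every direction step of every secret of the class, at every point.
[folklore] -/
theorem IsLineInvariant.apply_add_dirStep {X : Type*} {U : Finset (Fin (n + 1))} {bk : Fin (n + 1) → ℤ}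
    {f : (Fin (n + 1) → ZN D p₁ Q) → X} (hf : IsLineInvariant n D p₁ Q U bk f)
    {b : Fin (n + 1) → ℤ} (hb : InClass n p₁ U bk b) (y : Fin (n + 1) → ZN D p₁ Q) (m : ℤ) :
    f (y + dirStep n D p₁ Q m b) = f y := by
  have hy : (fun i => (((((y i).val : ℕ) : ℤ) : ℤ) : ZN D p₁ Q)) = y := funext fun i => by
    rw [Int.cast_natCast, ZMod.natCast_zmod_val]
  have h := hf b hb (fun i => (((y i).val : ℕ) : ℤ)) ((m : ℤ) : ZP p₁ Q) 0
  rwa [ptB_intCast, ptB_zero, hy] at h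

/-- **Line invariants = `H`-periodic register functions.** For `bk ≡ 0 (mod 2p₁)` on `U`, a function of
the registers is constant on every admissible line iff it is periodic under the span
`H = {2D²(m·bk + 2p₁e·𝟙_U)}` of the admissible directions: the line invariants reveal exactly the coset
`v′ + H` of the offset. [cite: ChenQuantumLattice2024, §3.5.9 p. 35, eq. (12) p. 17] -/
theorem isLineInvariant_iff_periodic (U : Finset (Fin (n + 1))) (bk : Fin (n + 1) → ℤ)
    (hbk : ∀ i, i ∈ U → (2 * ((p₁ : ℕ) : ℤ)) ∣ bk i) {X : Type*} (f : (Fin (n + 1) → ZN D p₁ Q) → X) :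
    IsLineInvariant n D p₁ Q U bk f
      ↔ ∀ (x h : Fin (n + 1) → ZN D p₁ Q), InDirSpan n D p₁ Q U bk h → f (x + h) = f x := by
  have hbk_in : InClass n p₁ U bk bk := ⟨fun _ _ => rfl, hbk⟩
  constructor
  · rintro hf x h ⟨m, e, hh⟩
    let b'' : Fin (n + 1) → ℤ := fun i => bk i + if i ∈ U then 2 * ((p₁ : ℕ) : ℤ) * e i else 0
    have hb''_in : InClass n p₁ U bk b'' := by
      refine ⟨fun i hi => by simp [b'', hi], fun i hi => ?_⟩
      simp only [b'', hi, if_true]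
      exact dvd_add (hbk i hi) (dvd_mul_right _ _)
    have hsplit : h = dirStep n D p₁ Q m bk + (dirStep n D p₁ Q 1 b'' - dirStep n D p₁ Q 1 bk) := by
      funext i
      rw [hh i, Pi.add_apply, Pi.sub_apply]
      simp only [dirStep, b'']
      by_cases hi : i ∈ U
      · simp only [hi, if_true]; push_cast; ring
      · simp only [hi, if_false]; push_cast; ring
    rw [hsplit, ← add_assoc, ← add_sub_assoc]
    calc f (x + dirStep n D p₁ Q m bk + dirStep n D p₁ Q 1 b'' - dirStep n D p₁ Q 1 bk)
        = f (x + dirStep n D p₁ Q m bk + dirStep n D p₁ Q 1 b'' - dirStep n D p₁ Q 1 bk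
              + dirStep n D p₁ Q 1 bk) := (hf.apply_add_dirStep n D p₁ Q hbk_in _ 1).symm
      _ = f (x + dirStep n D p₁ Q m bk + dirStep n D p₁ Q 1 b'') := by rw [sub_add_cancel]
      _ = f (x + dirStep n D p₁ Q m bk) := hf.apply_add_dirStep n D p₁ Q hb''_in _ 1
      _ = f x := hf.apply_add_dirStep n D p₁ Q hbk_in _ m
  · intro hper b hb v' j j'
    have key : ∀ j : ZP p₁ Q, f (ptB n D p₁ Q b v' j) = f (fun i => ((v' i : ℤ) : ZN D p₁ Q)) := by
      intro j
      have hj : ptB n D p₁ Q b v' j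
          = (fun i => ((v' i : ℤ) : ZN D p₁ Q)) + dirStep n D p₁ Q ((j.val : ℕ) : ℤ) b := by
        have h := ptB_intCast n D p₁ Q b v' ((j.val : ℕ) : ℤ)
        rwa [Int.cast_natCast, ZMod.natCast_zmod_val] at h
      rw [hj]
      refine hper _ _ ⟨((j.val : ℕ) : ℤ),
        fun i => ((j.val : ℕ) : ℤ) * ((b i - bk i) / (2 * ((p₁ : ℕ) : ℤ))), fun i => ?_⟩
      simp only [dirStep]
      congr 1
      by_cases hi : i ∈ U
      · rw [if_pos hi]
        have hdiv : 2 * ((p₁ : ℕ) : ℤ) ∣ b i - bk i := dvd_sub (hb.2 i hi) (hbk i hi)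
        have hcancel : 2 * ((p₁ : ℕ) : ℤ) * ((b i - bk i) / (2 * ((p₁ : ℕ) : ℤ))) = b i - bk i :=
          Int.mul_ediv_cancel' hdiv
        calc 2 * ((D : ℕ) : ℤ) ^ 2 * ((j.val : ℕ) : ℤ) * b i
            = 2 * ((D : ℕ) : ℤ) ^ 2 * (((j.val : ℕ) : ℤ) * bk i
                + ((j.val : ℕ) : ℤ) * (2 * ((p₁ : ℕ) : ℤ) * ((b i - bk i) / (2 * ((p₁ : ℕ) : ℤ))))) := by
              rw [hcancel]; ring
          _ = 2 * ((D : ℕ) : ℤ) ^ 2 * (((j.val : ℕ) : ℤ) * bk i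
                + 2 * ((p₁ : ℕ) : ℤ) * (((j.val : ℕ) : ℤ) * ((b i - bk i) / (2 * ((p₁ : ℕ) : ℤ))))) := by
              ring
      · rw [if_neg hi, hb.1 i hi]
        ring
    rw [key j, key j']

/-! ### The class shifts are exactly the invisible offset changes -/

/-- Every class shift `d(a,c)` lies in the span `H` (odd `Q`: `2` and `4` are units mod `Q`).
[cite: ChenQuantumLattice2024, §3.5.9 p. 35] -/
theorem inDirSpan_classShift (hQ : Odd ((Q : ℕ+) : ℕ)) (U : Finset (Fin (n + 1))) (bk : Fin (n + 1) → ℤ)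
    (a : ZQ Q) (c : Fin (n + 1) → ZQ Q) :
    InDirSpan n D p₁ Q U bk (fun i => ((classShift n D p₁ Q U bk a c i : ℤ) : ZN D p₁ Q)) := by
  obtain ⟨k, hk⟩ := hQ
  have h2 : 2 * ((k : ℤ) + 1) ≡ 1 [ZMOD (((Q : ℕ+) : ℕ) : ℤ)] :=
    Int.ModEq.symm (Int.modEq_iff_dvd.2 ⟨1, by rw [hk]; push_cast; ring⟩)
  refine ⟨((p₁ : ℕ) : ℤ) * (((a.val : ℕ) : ℤ) * ((k : ℤ) + 1)),
    fun i => ((classTail n Q U c i : ℕ) : ℤ) * ((k : ℤ) + 1) ^ 2, fun i => ?_⟩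
  have hy : ((a.val : ℕ) : ℤ) * bk i + ((classTail n Q U c i : ℕ) : ℤ)
      ≡ 2 * ((k : ℤ) + 1) * (((a.val : ℕ) : ℤ) * bk i)
          + (2 * ((k : ℤ) + 1)) ^ 2 * ((classTail n Q U c i : ℕ) : ℤ) [ZMOD (((Q : ℕ+) : ℕ) : ℤ)] := by
    have e1 := h2.mul_right (((a.val : ℕ) : ℤ) * bk i)
    have e2 := (h2.pow 2).mul_right ((classTail n Q U c i : ℕ) : ℤ)
    have e := e1.add e2
    rw [one_mul, one_pow, one_mul] at e
    exact e.symm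
  have key := Dsq_p₁_mul_eq_of_modEq D p₁ Q hy
  dsimp only
  unfold classShift
  rw [key]
  congr 1
  by_cases hi : i ∈ U
  · simp only [hi, if_true, classTail]; ring
  · simp only [hi, if_false, classTail]; push_cast; ring

/-- Every class shift has Step-8 value `0` (`0 ∉ U`). [cite: ChenQuantumLattice2024, Claim 3.14 pp. 33–34] -/
theorem toStep8_classShift (U : Finset (Fin (n + 1))) (hU : (0 : Fin (n + 1)) ∉ U) (bk : Fin (n + 1) → ℤ)
    (a : ZQ Q) (c : Fin (n + 1) → ZQ Q) :
    toStep8 D p₁ Q ((classShift n D p₁ Q U bk a c 0 : ℤ) : ZN D p₁ Q) = 0 := by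
  rw [toStep8_intCast, ZMod.intCast_zmod_eq_zero_iff_dvd]
  unfold classShift classTail
  rw [if_neg hU]
  exact ⟨((a.val : ℕ) : ℤ) * bk 0, by push_cast; ring⟩

/-- **The converse: an invisible offset change is a class shift.** For odd `p₁`, `0 ∉ U` and
`bk₀ = −1` (any `Q`), an element of the span `H` whose coordinate `0` is `≡ 0 (mod D²p₁)` is
`≡ d(a,c) (mod N)` for some class shift. [cite: ChenQuantumLattice2024, Claim 3.14 pp. 33–34, §3.5.9 p. 35] -/
theorem exists_classShift_of_inDirSpan (hp : Odd ((p₁ : ℕ+) : ℕ))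
    (U : Finset (Fin (n + 1))) (hU : (0 : Fin (n + 1)) ∉ U) (bk : Fin (n + 1) → ℤ) (hbk0 : bk 0 = -1)
    {h : Fin (n + 1) → ZN D p₁ Q} (hspan : InDirSpan n D p₁ Q U bk h) (h8 : toStep8 D p₁ Q (h 0) = 0) :
    ∃ (a : ZQ Q) (c : Fin (n + 1) → ZQ Q),
      ∀ i, h i = ((classShift n D p₁ Q U bk a c i : ℤ) : ZN D p₁ Q) := by
  obtain ⟨m, e, hh⟩ := hspan
  -- coordinate 0: `D²p₁ ∣ 2D²m`, so `p₁ ∣ m`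
  rw [hh 0, if_neg hU, hbk0, toStep8_intCast, ZMod.intCast_zmod_eq_zero_iff_dvd] at h8
  obtain ⟨k, hk⟩ := h8
  have hD : ((D : ℕ) : ℤ) ≠ 0 := by exact_mod_cast PNat.ne_zero D
  have hmk : ((D : ℕ) : ℤ) ^ 2 * (2 * m + ((p₁ : ℕ) : ℤ) * k) = 0 := by
    push_cast at hk
    linear_combination (-1 : ℤ) * hk
  have h2m : 2 * m + ((p₁ : ℕ) : ℤ) * k = 0 := by
    rcases mul_eq_zero.1 hmk with h0 | h0
    · exact absurd h0 (pow_ne_zero 2 hD)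
    · exact h0
  have hdvd : ((p₁ : ℕ) : ℤ) ∣ m * 2 := ⟨-k, by linear_combination h2m⟩
  have hcop : IsCoprime ((p₁ : ℕ) : ℤ) ((2 : ℕ) : ℤ) :=
    Nat.isCoprime_iff_coprime.2 (Nat.coprime_two_left.2 hp).symm
  rw [Nat.cast_ofNat] at hcop
  obtain ⟨m', rfl⟩ := hcop.dvd_of_dvd_mul_right hdvd
  -- the class shift with `a = 2m'`, `c = 4e`
  refine ⟨((2 * m' : ℤ) : ZQ Q), fun i => ((4 * e i : ℤ) : ZQ Q), fun i => ?_⟩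
  have ha : (((((2 * m' : ℤ) : ZQ Q)).val : ℕ) : ℤ) ≡ 2 * m' [ZMOD (((Q : ℕ+) : ℕ) : ℤ)] := by
    rw [ZMod.val_intCast]
    exact Int.mod_modEq _ _
  rw [hh i]
  unfold classShift classTail
  by_cases hi : i ∈ U
  · rw [if_pos hi, if_pos hi]
    have hc : (((((4 * e i : ℤ) : ZQ Q)).val : ℕ) : ℤ) ≡ 4 * e i [ZMOD (((Q : ℕ+) : ℕ) : ℤ)] := by
      rw [ZMod.val_intCast]
      exact Int.mod_modEq _ _
    rw [Dsq_p₁_mul_eq_of_modEq D p₁ Q ((ha.mul_right (bk i)).add hc)]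
    congr 1
    ring
  · rw [if_neg hi, if_neg hi, Nat.cast_zero]
    rw [Dsq_p₁_mul_eq_of_modEq D p₁ Q ((ha.mul_right (bk i)).add_right 0)]
    congr 1
    ring

/-- **`(H ∩ Step-8-invisible) = the class shifts mod N`** (odd `p₁`, odd `Q`, `0 ∉ U`, `bk₀ = −1`).
[cite: ChenQuantumLattice2024, Claim 3.14 pp. 33–34, §3.5.9 p. 35] -/
theorem inDirSpan_step8_iff_classShift (hp : Odd ((p₁ : ℕ+) : ℕ)) (hQ : Odd ((Q : ℕ+) : ℕ))
    (U : Finset (Fin (n + 1))) (hU : (0 : Fin (n + 1)) ∉ U) (bk : Fin (n + 1) → ℤ) (hbk0 : bk 0 = -1)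
    (h : Fin (n + 1) → ZN D p₁ Q) :
    (InDirSpan n D p₁ Q U bk h ∧ toStep8 D p₁ Q (h 0) = 0)
      ↔ ∃ (a : ZQ Q) (c : Fin (n + 1) → ZQ Q),
          ∀ i, h i = ((classShift n D p₁ Q U bk a c i : ℤ) : ZN D p₁ Q) := by
  constructor
  · rintro ⟨hspan, h8⟩
    exact exists_classShift_of_inDirSpan n D p₁ Q hp U hU bk hbk0 hspan h8
  · rintro ⟨a, c, hac⟩
    have hh : h = fun i => ((classShift n D p₁ Q U bk a c i : ℤ) : ZN D p₁ Q) := funext hac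
    rw [hh]
    exact ⟨inDirSpan_classShift n D p₁ Q hQ U bk a c, toStep8_classShift n D p₁ Q U hU bk a c⟩

/-- **No line invariant sees a class shift** (any value type): `f(v′ + d(a,c)) = f(v′)` (odd `Q`,
`bk ≡ 0 (mod 2p₁)` on `U`). [cite: ChenQuantumLattice2024, §3.5.9 p. 35] -/
theorem IsLineInvariant.apply_classShift (hQ : Odd ((Q : ℕ+) : ℕ)) {U : Finset (Fin (n + 1))}
    {bk : Fin (n + 1) → ℤ} (hbk : ∀ i, i ∈ U → (2 * ((p₁ : ℕ) : ℤ)) ∣ bk i) {X : Type*}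
    {f : (Fin (n + 1) → ZN D p₁ Q) → X} (hf : IsLineInvariant n D p₁ Q U bk f)
    (v' : Fin (n + 1) → ℤ) (a : ZQ Q) (c : Fin (n + 1) → ZQ Q) :
    f (fun i => ((v' i + classShift n D p₁ Q U bk a c i : ℤ) : ZN D p₁ Q))
      = f (fun i => ((v' i : ℤ) : ZN D p₁ Q)) := by
  have hsplit : (fun i => ((v' i + classShift n D p₁ Q U bk a c i : ℤ) : ZN D p₁ Q))
      = (fun i => ((v' i : ℤ) : ZN D p₁ Q))
          + fun i => ((classShift n D p₁ Q U bk a c i : ℤ) : ZN D p₁ Q) := by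
    funext i
    rw [Pi.add_apply, Int.cast_add]
  rw [hsplit]
  exact (isLineInvariant_iff_periodic n D p₁ Q U bk hbk f).1 hf _ _
    (inDirSpan_classShift n D p₁ Q hQ U bk a c)

/-- **T4, modelling half: what is knowable about the offset without the secret is exactly its class.**
For odd `p₁`, odd `Q`, `0 ∉ U`, `bk₀ = −1` and `bk ≡ 0 (mod 2p₁)` on `U`: two offsets `v′, v″` receive the
same value of EVERY line invariant and the same Step-8 datum `v₀ mod D²p₁` if and only if
`v″ ≡ v′ + d(a,c) (mod N)` for a class shift `d(a,c) = D²p₁(a·bk + c·𝟙_U)`.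
[cite: ChenQuantumLattice2024, Claim 3.14 pp. 33–34, §3.5.9 p. 35, eq. (12) p. 17] -/
theorem offset_indistinguishable_iff (hp : Odd ((p₁ : ℕ+) : ℕ)) (hQ : Odd ((Q : ℕ+) : ℕ))
    (U : Finset (Fin (n + 1))) (hU : (0 : Fin (n + 1)) ∉ U) (bk : Fin (n + 1) → ℤ) (hbk0 : bk 0 = -1)
    (hbk : ∀ i, i ∈ U → (2 * ((p₁ : ℕ) : ℤ)) ∣ bk i) (v' v'' : Fin (n + 1) → ℤ) :
    ((∀ f : (Fin (n + 1) → ZN D p₁ Q) → Prop, IsLineInvariant n D p₁ Q U bk f →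
        (f (fun i => ((v' i : ℤ) : ZN D p₁ Q)) ↔ f (fun i => ((v'' i : ℤ) : ZN D p₁ Q))))
      ∧ toStep8 D p₁ Q (((v' 0 : ℤ) : ZN D p₁ Q)) = toStep8 D p₁ Q (((v'' 0 : ℤ) : ZN D p₁ Q)))
    ↔ ∃ (a : ZQ Q) (c : Fin (n + 1) → ZQ Q),
        ∀ i, ((v'' i : ℤ) : ZN D p₁ Q) = ((v' i + classShift n D p₁ Q U bk a c i : ℤ) : ZN D p₁ Q) := by
  constructor
  · rintro ⟨hinv, h8⟩
    -- the invariant "y − v′ ∈ H"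
    let f : (Fin (n + 1) → ZN D p₁ Q) → Prop :=
      fun y => InDirSpan n D p₁ Q U bk (y - fun i => ((v' i : ℤ) : ZN D p₁ Q))
    have hf : IsLineInvariant n D p₁ Q U bk f := by
      rw [isLineInvariant_iff_periodic n D p₁ Q U bk hbk]
      intro x h hh
      show InDirSpan n D p₁ Q U bk (x + h - fun i => ((v' i : ℤ) : ZN D p₁ Q))
        = InDirSpan n D p₁ Q U bk (x - fun i => ((v' i : ℤ) : ZN D p₁ Q))
      rw [add_sub_right_comm]
      refine propext ⟨fun hx => ?_, fun hx => inDirSpan_add n D p₁ Q hx hh⟩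
      have h' := inDirSpan_add n D p₁ Q hx (inDirSpan_neg n D p₁ Q hh)
      rwa [add_neg_cancel_right] at h'
    have h0 : f (fun i => ((v' i : ℤ) : ZN D p₁ Q)) := by
      show InDirSpan n D p₁ Q U bk _
      rw [sub_self]
      exact inDirSpan_zero n D p₁ Q U bk
    have hd : InDirSpan n D p₁ Q U bk
        ((fun i => ((v'' i : ℤ) : ZN D p₁ Q)) - fun i => ((v' i : ℤ) : ZN D p₁ Q)) := (hinv f hf).1 h0
    have h8' : toStep8 D p₁ Q
        (((fun i => ((v'' i : ℤ) : ZN D p₁ Q)) - fun i => ((v' i : ℤ) : ZN D p₁ Q)) 0) = 0 := by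
      rw [Pi.sub_apply, map_sub, h8, sub_self]
    obtain ⟨a, c, hac⟩ := exists_classShift_of_inDirSpan n D p₁ Q hp U hU bk hbk0 hd h8'
    refine ⟨a, c, fun i => ?_⟩
    have hi := hac i
    rw [Pi.sub_apply, sub_eq_iff_eq_add'] at hi
    rw [hi, Int.cast_add]
  · rintro ⟨a, c, hac⟩
    have hv'' : (fun i => ((v'' i : ℤ) : ZN D p₁ Q))
        = fun i => ((v' i + classShift n D p₁ Q U bk a c i : ℤ) : ZN D p₁ Q) := funext hac
    refine ⟨fun f hf => ?_, ?_⟩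
    · rw [hv'', hf.apply_classShift n D p₁ Q hQ hbk v' a c]
    · rw [hac 0, Int.cast_add, map_add, toStep8_classShift n D p₁ Q U hU bk a c, add_zero]

end LineInvariants

end Literature.Computability.Cryptography.Chen2024
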